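import Literature.NumberTheory.Rogawski1990.ArchStableTorusOrbitalWallDeriv     -- ★ p840417 J1 (this seat): the per-place two-wall jump formula + §1 differentiability; ★ relabel transport p840351
import Literature.NumberTheory.Automorphic.ArchTorusOrbitalFubiniSmooth         -- ★ p840553 (V7)-smooth §4 `exists_contDiff_partialOrbital_eq`; brings ★ p840257 (V7) (h0), (h4)
import Literature.NumberTheory.Automorphic.ArchTorusOrbitalFunctionAtPoint      -- ★ (j2) `archStableOrbitalIntegral_archDiagTorus_eq_inv_mul_sum_integral_conj`
import HarnessLib

/-!
# The `ψ`-derivative jump of the GLOBAL stable torus orbital integral `Φ^st_∞(t(z^ψ), f_∞)` at a split-singular wall of ONE indefinite place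
# ((δ) «(L-st) regular half assembled at one indefinite place»; Rogawski 1990 §8.2 p. 122–124, §14.5 p. 238–239)

Topic `NumberTheory/Rogawski1990`; namespace `Literature.NumberTheory.Rogawski1990`.  THEOREMS ONLY (no `def`, no instance, no notation, no axiom, no `sorry`).
Cell `pub/hodgecm-mathlib`, ENGINE T1 (crux H413 = `stmt-HodgeConjecture-24833`); floor-2 road «(J-nc) in-house», brick (δ) (LEAD F0P3a-plan (g9) WORD T8-44 (A),
2026-09-01; author F0P3a-p07 (g7); census `CENSUS-delta-LstRegularHalf` fad591492ead839c).

SETTING.  `L` CM, weights `α : Fin 3 → L` (`α_i ≠ 0`, `c α_i = α_i`), `G′_∞ = U(diag α)(L⁺ ⊗ ℝ) ≃ₜ* Π_w G_w` (★ `arch`, `archPiEquivCM`), per-place Haar measures `ν_w`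
and the product convention `ν = e⁻¹_*(⊗ ν_w)` (★ (V7) (h0)), an orbital-measure family `m` canonical on the regular classes for `ν` (★ (V8)-orb `IsCanonical`).
A place `w₀`, a global torus point `z : W → Fin 3 → S¹` REGULAR AT EVERY `w ≠ w₀` whose `w₀`-coordinate lies on the split wall `z w₀ 0 = z w₀ 2 ≠ z w₀ 1`,
and the global one-angle curve `z^ψ := Function.update z w₀ (i ↦ z w₀ i · e^{i(1,0,−1)_i ψ})` moving ONLY the `w₀`-coordinate.  TEST FUNCTIONS: the global
ambient-smooth currency `Θ : M₃(L ⊗ ℝ) → ℂ`, `ContDiff ℝ ⊤ Θ`, compact support on the group (`a = Θ ∘ coe`).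

WHAT IS PROVED (everything by import; the analysis is J1 ★ p840417 at `w₀`, the bookkeeping is ★ (V7) Fubini + ★ (V7)-smooth + ★ (j2)).
* §1 `partialOrbital_update_comp_eq` — the (V7) PARTIAL ORBITAL lambda at `(update z w₀ u) ∘ ρ` does not see the `w₀`-slot; `eventually_forall_injective_update_splitCurve_comp`
  — `z^ψ ∘ ρ` is regular at EVERY place for all small `ψ > 0` (★ `eventually_injective_splitCurve`).
* §2 `integral_comp_conj_archDiagTorus_update_comp_eq_integral_partial` — for regular `z^ψ ∘ ρ`: the GLOBAL torus orbital integral of `a` at `t(z^ψ ∘ ρ)` is the `w₀`-torus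
  orbital integral of the partial orbital lambda `PO_{z∘ρ}` at `diag(γ(ψ) ∘ ρ_{w₀})` ((h4) ★).
* §3 **`exists_tendsto_deriv_sin_mul_archStableOrbitalIntegral_update_splitCurve`** — THE HEAD: assuming the (J-nc) letter at `w₀` for the relabellings with a noncompact wall
  (J1's hypothesis `hJ`, discharged in ED. 2 by F0P3a-p06's (d3b)), there are constants `c τ ≠ 0` (noncompact walls) such that for every `Θ` and every such `z`,
  `∂_ψ [2 sin ψ · Φ^st_∞(t(z^ψ), a)] ⟶ K⁻¹ · Σ_{ρ : W → S₃} ℓ_ρ` as `ψ → 0+`, `K = Π_w p_w!(3−p_w)!` (★ (j2)), with `ℓ_ρ = 2·∫_{G_{w₀}} PO_{z∘ρ}(x·diag(z w₀ ∘ ρ_{w₀})·x⁻¹) dν_{w₀}`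
  at a COMPACT `w₀`-wall of `ρ_{w₀}` and `ℓ_ρ = c_{ρ_{w₀}⁻¹} · S_{w₀}(PO_{z∘ρ} ∘ e_{ρ_{w₀}⁻¹}; …)` (J1's singular orbital integral on `G_{w₀}(α ∘ ρ_{w₀}⁻¹) ∕ Z`, tokens VERBATIM) at a
  NONCOMPACT one — every right-hand quantity a group-currency integral of `Θ` (no `Θ'`, no definition).
NOT HERE: the compact-wall terms as GLOBAL group integrals at the singular point ((δ8): the (h4)-variant at a compact-wall `z_{w₀}`); the singular terms in the families' `atPoint`
currency (F0P3a-p03's J2 (ii) dictionary ★ `ArchSingularOrbitalIntegralDictionary`); the `hJ`-free edition ((γ), by import over F0P3a-p06's (d3b)).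
HONEST LABEL: HC_CM is proved only modulo the 7 printed citations until rung 0 closes; this file is bookkeeping over J1 and pays nothing by itself.

## References
* [Rogawski1990] J. D. Rogawski, *Automorphic Representations of Unitary Groups in Three Variables*, Ann. of Math. Stud. 123 (1990), §8.2 p. 122–124 (per-place
  differentiation of orbital integrals along the compact Cartan, the limit formulas (P3)(P4)), §8.3 p. 122, §14.5 p. 238–239 («method of §8.2»).
* [BorelJacquet1979] A. Borel, H. Jacquet, *Automorphic forms and automorphic representations*, PSPM 33.1 (1979), §4.1 (`G_∞ = Π_v G(F_v)`, product measures).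
* [Varadarajan1989] V. S. Varadarajan, *An Introduction to Harmonic Analysis on Semisimple Lie Groups* (1989), §6.4 Thm 22 (jump relations).
-/

set_option autoImplicit false

noncomputable section

open MeasureTheory Measure Filter Topology NumberField NumberField.InfinitePlace NumberField.mixedEmbedding Equiv Function Set
open Literature.MeasureTheory.Group Literature.NumberTheory.Automorphic Literature.NumberTheory.Automorphic.UnitaryGroup
open Literature.LinearAlgebra.Matrix
open scoped Matrix MatrixGroups Matrix.Norms.Operator ContDiff

namespace Literature.NumberTheory.Rogawski1990

variable (L : Type) [Field L] [NumberField L] [IsCMField L] (α : Fin 3 → L) (w : {w : InfinitePlace L // IsComplex w})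
  [MeasurableSpace (GL (Fin 3) ℂ)] [BorelSpace (GL (Fin 3) ℂ)]
  [MeasurableSpace (arch (↥(maximalRealSubfield L)) L (IsCMField.complexConj L) 3 (Matrix.diagonal α))] [BorelSpace (arch (↥(maximalRealSubfield L)) L (IsCMField.complexConj L) 3 (Matrix.diagonal α))]

/-! ## §1 Bookkeeping: the updated curve, its regularity -/

omit [NumberField L] [IsCMField L] [MeasurableSpace (GL (Fin 3) ℂ)] [BorelSpace (GL (Fin 3) ℂ)]
  [MeasurableSpace (arch (↥(maximalRealSubfield L)) L (IsCMField.complexConj L) 3 (Matrix.diagonal α))] [BorelSpace (arch (↥(maximalRealSubfield L)) L (IsCMField.complexConj L) 3 (Matrix.diagonal α))] in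
open scoped Classical in
/-- Off `w` the updated global torus point is the old one: `(update z w u) v ∘ ρ v = z v ∘ ρ v` for `v ≠ w`. [cite: Rogawski1990, §8.2 p. 122] -/
theorem update_apply_comp_of_ne (z : {w : InfinitePlace L // IsComplex w} → Fin 3 → Circle) (u : Fin 3 → Circle) (ρ : {w : InfinitePlace L // IsComplex w} → Perm (Fin 3)) (w' : {v : {w : InfinitePlace L // IsComplex w} // ¬ v = w}) :
    Function.update z w u w'.1 ∘ ⇑(ρ w'.1) = z w'.1 ∘ ⇑(ρ w'.1) := by
  rw [Function.update_of_ne w'.2]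

omit [NumberField L] [IsCMField L] [MeasurableSpace (GL (Fin 3) ℂ)] [BorelSpace (GL (Fin 3) ℂ)]
  [MeasurableSpace (arch (↥(maximalRealSubfield L)) L (IsCMField.complexConj L) 3 (Matrix.diagonal α))] [BorelSpace (arch (↥(maximalRealSubfield L)) L (IsCMField.complexConj L) 3 (Matrix.diagonal α))] in
open scoped Classical in
/-- At `w` the updated global torus point is the new coordinate: `(update z w u) w ∘ ρ w = u ∘ ρ w`. [cite: Rogawski1990, §8.2 p. 122] -/
theorem update_apply_comp_self (z : {w : InfinitePlace L // IsComplex w} → Fin 3 → Circle) (u : Fin 3 → Circle) (ρ : {w : InfinitePlace L // IsComplex w} → Perm (Fin 3)) :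
    Function.update z w u w ∘ ⇑(ρ w) = u ∘ ⇑(ρ w) := by
  rw [Function.update_self]

omit [NumberField L] [IsCMField L] [MeasurableSpace (GL (Fin 3) ℂ)] [BorelSpace (GL (Fin 3) ℂ)]
  [MeasurableSpace (arch (↥(maximalRealSubfield L)) L (IsCMField.complexConj L) 3 (Matrix.diagonal α))] [BorelSpace (arch (↥(maximalRealSubfield L)) L (IsCMField.complexConj L) 3 (Matrix.diagonal α))] in
open scoped Classical in
/-- Off `w` a relabelling split as `(ρ₀, ρ′)` (Mathlib `Equiv.funSplitAt w`) acts by `ρ′`. [cite: Rogawski1990, §8.2 p. 122] -/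
theorem funSplitAt_symm_apply_coe (p : Perm (Fin 3) × ({v : {w : InfinitePlace L // IsComplex w} // v ≠ w} → Perm (Fin 3))) (w' : {v : {w : InfinitePlace L // IsComplex w} // ¬ v = w}) :
    (Equiv.funSplitAt w (Perm (Fin 3))).symm p w'.1 = p.2 w' := by
  rw [Equiv.funSplitAt_symm_apply, dif_neg w'.2]

omit [NumberField L] [IsCMField L] [MeasurableSpace (GL (Fin 3) ℂ)] [BorelSpace (GL (Fin 3) ℂ)]
  [MeasurableSpace (arch (↥(maximalRealSubfield L)) L (IsCMField.complexConj L) 3 (Matrix.diagonal α))] [BorelSpace (arch (↥(maximalRealSubfield L)) L (IsCMField.complexConj L) 3 (Matrix.diagonal α))] in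
open scoped Classical in
/-- At `w` a relabelling split as `(ρ₀, ρ′)` acts by `ρ₀`. [cite: Rogawski1990, §8.2 p. 122] -/
theorem funSplitAt_symm_apply_self (p : Perm (Fin 3) × ({v : {w : InfinitePlace L // IsComplex w} // v ≠ w} → Perm (Fin 3))) :
    (Equiv.funSplitAt w (Perm (Fin 3))).symm p w = p.1 := by
  rw [Equiv.funSplitAt_symm_apply, dif_pos rfl]

omit [IsCMField L] [MeasurableSpace (GL (Fin 3) ℂ)] [BorelSpace (GL (Fin 3) ℂ)] in
open scoped Classical in
/-- Reindexing the relabellings `ρ : W → S₃` by (`ρ_w`, `ρ` off `w`) (Mathlib `Equiv.funSplitAt`, `Fintype.sum_prod_type_right'`). [cite: Rogawski1990, §8.2 p. 122] -/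
theorem sum_eq_sum_sum_funSplitAt {M : Type*} [AddCommMonoid M] (g : Perm (Fin 3) → (({v : {w : InfinitePlace L // IsComplex w} // v ≠ w} → Perm (Fin 3))) → M) :
    ∑ ρ : {w : InfinitePlace L // IsComplex w} → Perm (Fin 3), g (ρ w) (fun v => ρ v.1) =
      ∑ ρ' : {v : {w : InfinitePlace L // IsComplex w} // v ≠ w} → Perm (Fin 3), ∑ ρ₀ : Perm (Fin 3), g ρ₀ ρ' := by
  rw [← Fintype.sum_prod_type_right' g]
  exact Equiv.sum_comp (Equiv.funSplitAt w (Perm (Fin 3))) (fun p => g p.1 p.2)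

omit [NumberField L] [IsCMField L] [MeasurableSpace (GL (Fin 3) ℂ)] [BorelSpace (GL (Fin 3) ℂ)]
  [MeasurableSpace (arch (↥(maximalRealSubfield L)) L (IsCMField.complexConj L) 3 (Matrix.diagonal α))] [BorelSpace (arch (↥(maximalRealSubfield L)) L (IsCMField.complexConj L) 3 (Matrix.diagonal α))] in
open scoped Classical in
/-- **The updated split curve is REGULAR AT EVERY PLACE for all small `ψ > 0`** (and after every relabelling `ρ`): at `v ≠ w` by hypothesis, at `w` by
★ `eventually_injective_splitCurve`. [cite: Rogawski1990, §8.2 p. 122; §14.5 p. 238] -/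
theorem eventually_forall_injective_update_splitCurve_comp (z : {w : InfinitePlace L // IsComplex w} → Fin 3 → Circle)
    (hz : ∀ v, v ≠ w → Function.Injective (z v)) (h02 : z w 0 = z w 2) (h01 : z w 0 ≠ z w 1) :
    ∀ᶠ ψ in 𝓝[>] (0 : ℝ), ∀ (ρ : {w : InfinitePlace L // IsComplex w} → Perm (Fin 3)) (v : {w : InfinitePlace L // IsComplex w}),
      Function.Injective (Function.update z w (fun i => z w i * Circle.exp (![(1 : ℝ), 0, -1] i * ψ)) v ∘ ⇑(ρ v)) := by
  have h := (eventually_injective_splitCurve (z w) h02 h01).filter_mono (nhdsWithin_mono _ fun x (hx : 0 < x) => ne_of_gt hx)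
  refine h.mono fun ψ hψ ρ v => ?_
  by_cases hv : v = w
  · subst hv
    rw [Function.update_self]
    exact hψ.comp (ρ v).injective
  · rw [Function.update_of_ne hv]
    exact (hz v hv).comp (ρ v).injective

/-! ## §2 The global torus orbital integral along the updated curve is the `w`-torus orbital integral of the partial orbital lambda -/

open scoped Classical in
/-- **GLOBAL = PER-PLACE AT `w` ALONG THE UPDATED CURVE** ((h4) ★ `integral_comp_conj_archDiagTorus_eq_integral_partial` at the regular point `(update z w u) ∘ ρ`, with the
`w`-slot and the off-`w` slots of the updated point read back by §1): the global torus orbital integral of `a = Θ ∘ coe` at `t((update z w u) ∘ ρ)` is the `w`-torus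
orbital integral, at `diag(u ∘ ρ_w)`, of the PARTIAL ORBITAL lambda `PO_{z∘ρ}` over the places `v ≠ w` (tokens of ★ `exists_contDiff_partialOrbital_eq`).
[cite: Rogawski1990, §8.2 p. 123; §8.3 p. 122] [cite: BorelJacquet1979, §4.1] -/
theorem integral_comp_conj_archDiagTorus_update_comp_eq_integral_partial
    (νw : ∀ v : {w : InfinitePlace L // IsComplex w}, Measure (archLocal L 3 (Matrix.diagonal α) v)) [∀ v, (νw v).IsHaarMeasure]
    (hα : ∀ i, α i ≠ 0) (Θ : Matrix (Fin 3) (Fin 3) (mixedSpace L) → ℂ) (hΘ : Continuous Θ)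
    (hΘc : HasCompactSupport fun g : arch (↥(maximalRealSubfield L)) L (IsCMField.complexConj L) 3 (Matrix.diagonal α) => Θ ((g : GL (Fin 3) (mixedSpace L)) : Matrix (Fin 3) (Fin 3) (mixedSpace L)))
    (z : {w : InfinitePlace L // IsComplex w} → Fin 3 → Circle) (u : Fin 3 → Circle) (ρ : {w : InfinitePlace L // IsComplex w} → Perm (Fin 3))
    (hreg : ∀ v, Function.Injective (Function.update z w u v ∘ ⇑(ρ v))) :
    ∫ g, Θ (((g * archDiagTorus L 3 α (fun v => Function.update z w u v ∘ ⇑(ρ v)) * g⁻¹ : arch (↥(maximalRealSubfield L)) L (IsCMField.complexConj L) 3 (Matrix.diagonal α)) : GL (Fin 3) (mixedSpace L)) : Matrix (Fin 3) (Fin 3) (mixedSpace L))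
        ∂((Measure.pi νw).map (archPiEquivCM 3 L (Matrix.diagonal α)).symm) =
      ∫ x : archLocal L 3 (Matrix.diagonal α) w,
        (fun x' : archLocal L 3 (Matrix.diagonal α) w =>
          ∫ b : (∀ w' : {v : {w : InfinitePlace L // IsComplex w} // ¬ v = w}, archLocal L 3 (Matrix.diagonal α) w'.1),
            Θ ((((archPiEquivCM 3 L (Matrix.diagonal α)).symm
              ((MeasurableEquiv.piEquivPiSubtypeProd (fun v : {w : InfinitePlace L // IsComplex w} => ↥(archLocal L 3 (Matrix.diagonal α) v)) (· = w)).symm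
                ((MeasurableEquiv.piUnique fun i : {v : {w : InfinitePlace L // IsComplex w} // v = w} => ↥(archLocal L 3 (Matrix.diagonal α) i.1)).symm x',
                  fun w' => b w' * ⟨circleDiagonal 3 (z w'.1 ∘ ⇑(ρ w'.1)), circleDiagonal_mem_archLocal_diagonal L 3 α w'.1 (z w'.1 ∘ ⇑(ρ w'.1))⟩ * (b w')⁻¹)) :
                arch (↥(maximalRealSubfield L)) L (IsCMField.complexConj L) 3 (Matrix.diagonal α)) : GL (Fin 3) (mixedSpace L)) : Matrix (Fin 3) (Fin 3) (mixedSpace L))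
            ∂(Measure.pi fun w' : {v : {w : InfinitePlace L // IsComplex w} // ¬ v = w} => νw w'.1))
          (x * ⟨circleDiagonal 3 (u ∘ ⇑(ρ w)), circleDiagonal_mem_archLocal_diagonal L 3 α w (u ∘ ⇑(ρ w))⟩ * x⁻¹) ∂(νw w) := by
  haveI : ∀ v : {w : InfinitePlace L // IsComplex w}, LocallyCompactSpace (archLocal L 3 (Matrix.diagonal α) v) := fun v => locallyCompactSpace_archLocal L 3 (Matrix.diagonal α) v
  haveI : ∀ v : {w : InfinitePlace L // IsComplex w}, SecondCountableTopology (archLocal L 3 (Matrix.diagonal α) v) := fun v => secondCountableTopology_archLocal L 3 (Matrix.diagonal α) v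
  have hf : Continuous fun g : arch (↥(maximalRealSubfield L)) L (IsCMField.complexConj L) 3 (Matrix.diagonal α) => Θ ((g : GL (Fin 3) (mixedSpace L)) : Matrix (Fin 3) (Fin 3) (mixedSpace L)) :=
    hΘ.comp (Units.continuous_val.comp continuous_subtype_val)
  have h := integral_comp_conj_archDiagTorus_eq_integral_partial L 3 α νw hα w _ hf hΘc (z := fun v => Function.update z w u v ∘ ⇑(ρ v)) hreg
  rw [h]
  simp only [update_apply_comp_of_ne, update_apply_comp_self]

/-! ## §3 The head: the derivative jump of `2 sin ψ · Φ^st_∞(t(z^ψ), a)` at a split-singular wall of one indefinite place -/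

open scoped Classical in
/-- **(δ) «(L-st) REGULAR HALF AT ONE INDEFINITE PLACE» — THE `ψ`-DERIVATIVE JUMP OF THE GLOBAL STABLE TORUS ORBITAL INTEGRAL** [Rogawski1990 §8.2 p. 124 (P4), §14.5 p. 238].
`L` CM, weights `α` (`α_i ≠ 0`, `c α_i = α_i`), a place `w`; per-place Haar measures `ν_v`, `ν = e⁻¹_*(⊗ ν_v)` on `G′_∞`, `m` canonical on the regular classes for `ν`; the (J-nc) letter at
`w` for the relabellings `τ` with a NONCOMPACT `{0,2}`-wall (hypothesis `hJ`, as in J1 ★ — discharged in ED. 2); `z₁`, `νH τ` J1's auxiliary wall point and centraliser measures.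
THEN there are constants `c τ`, NON-ZERO at the noncompact walls, such that for every `Θ : M₃(L ⊗ ℝ) → ℂ` smooth with compact support on `G′_∞` and every global torus point `z`
REGULAR OFF `w` with `z w` on the wall (`z w 0 = z w 2 ≠ z w 1`), along `z^ψ = update z w (γ_{z w}(ψ))`:
`∂_ψ [2 sin ψ · Φ^st_∞(t(z^ψ), Θ∘↑↑·)] ⟶ K⁻¹ · Σ_{ρ : W → S₃} ℓ_ρ` (`ψ → 0+`), `K = Π_v p_v!(3−p_v)!` (★ (j2)), `ℓ_ρ = 2·∫_{G_w} PO_{z∘ρ}(x·diag(z w ∘ ρ_w)·x⁻¹) dν_w` if the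
`w`-wall of `ρ_w` is COMPACT and `ℓ_ρ = c_{ρ_w⁻¹} · S_w(PO_{z∘ρ} ∘ e_{ρ_w⁻¹})` (J1's singular orbital integral on `G_w(α∘ρ_w⁻¹) ∕ Z(diag z₁)`, tokens verbatim) if it is NONCOMPACT, where
`PO_{z∘ρ}` is the (V7) PARTIAL ORBITAL lambda of `Θ` over the places `v ≠ w` at `(z_v ∘ ρ_v)_v` and `e_τ` J1's relabelling isomorphism — every right-hand quantity a
group-currency integral of `Θ`.  PROOF BY IMPORT: ★ (j2) + §2 + ★ (V7)-smooth §4 (one `Θ′` per off-`w` relabelling) make the function EVENTUALLY a finite sum of J1's functions; J1 ★ termwise.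
[cite: Rogawski1990, §8.2 p. 124; §14.5 p. 238] [cite: Varadarajan1989, §6.4 Thm 22] [cite: BorelJacquet1979, §4.1] -/
theorem exists_tendsto_deriv_sin_mul_archStableOrbitalIntegral_update_splitCurve
    (hα : ∀ i, α i ≠ 0) (hherm : ∀ i, (IsCMField.complexConj L (α i) : L) = α i)
    (hJ : ∀ τ : Perm (Fin 3), (w.1.embedding (α (τ 0))).re * (w.1.embedding (α (τ 2))).re < 0 → ArchLimitFormulaNoncompactWall L (α ∘ ⇑τ) w)
    (νw : ∀ v : {w : InfinitePlace L // IsComplex w}, Measure (archLocal L 3 (Matrix.diagonal α) v)) [∀ v, (νw v).IsHaarMeasure]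
    (ν : Measure (archLocal L 3 (Matrix.diagonal α) w)) [ν.IsHaarMeasure] [ν.IsMulRightInvariant] (hνw : νw w = ν)
    [∀ g : arch (↥(maximalRealSubfield L)) L (IsCMField.complexConj L) 3 (Matrix.diagonal α), MeasurableSpace (arch (↥(maximalRealSubfield L)) L (IsCMField.complexConj L) 3 (Matrix.diagonal α) ⧸ Subgroup.centralizer ({g} : Set (arch (↥(maximalRealSubfield L)) L (IsCMField.complexConj L) 3 (Matrix.diagonal α))))]
    [∀ g : arch (↥(maximalRealSubfield L)) L (IsCMField.complexConj L) 3 (Matrix.diagonal α), BorelSpace (arch (↥(maximalRealSubfield L)) L (IsCMField.complexConj L) 3 (Matrix.diagonal α) ⧸ Subgroup.centralizer ({g} : Set (arch (↥(maximalRealSubfield L)) L (IsCMField.complexConj L) 3 (Matrix.diagonal α))))]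
    (νinf : Measure (arch (↥(maximalRealSubfield L)) L (IsCMField.complexConj L) 3 (Matrix.diagonal α))) [νinf.IsHaarMeasure] [νinf.IsMulRightInvariant]
    (hνinf : νinf = (Measure.pi νw).map (archPiEquivCM 3 L (Matrix.diagonal α)).symm)
    {m : OrbitalMeasureFamily ↥(arch (↥(maximalRealSubfield L)) L (IsCMField.complexConj L) 3 (Matrix.diagonal α))}
    (hm : m.IsCanonical (fun γ => IsRegularElt (γ.val : GL (Fin 3) (mixedSpace L))) νinf)
    (z₁ : Fin 3 → Circle) (h02 : z₁ 0 = z₁ 2) (h01 : z₁ 0 ≠ z₁ 1)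
    [∀ τ : Perm (Fin 3), MeasurableSpace (archLocal L 3 (Matrix.diagonal (α ∘ ⇑τ)) w ⧸ Subgroup.centralizer
      ({(⟨circleDiagonal 3 z₁, circleDiagonal_mem_archLocal_diagonal L 3 (α ∘ ⇑τ) w z₁⟩ : archLocal L 3 (Matrix.diagonal (α ∘ ⇑τ)) w)} :
        Set (archLocal L 3 (Matrix.diagonal (α ∘ ⇑τ)) w)))]
    [∀ τ : Perm (Fin 3), BorelSpace (archLocal L 3 (Matrix.diagonal (α ∘ ⇑τ)) w ⧸ Subgroup.centralizer
      ({(⟨circleDiagonal 3 z₁, circleDiagonal_mem_archLocal_diagonal L 3 (α ∘ ⇑τ) w z₁⟩ : archLocal L 3 (Matrix.diagonal (α ∘ ⇑τ)) w)} :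
        Set (archLocal L 3 (Matrix.diagonal (α ∘ ⇑τ)) w)))]
    (νH : ∀ τ : Perm (Fin 3), Measure (Subgroup.centralizer
      ({(⟨circleDiagonal 3 z₁, circleDiagonal_mem_archLocal_diagonal L 3 (α ∘ ⇑τ) w z₁⟩ : archLocal L 3 (Matrix.diagonal (α ∘ ⇑τ)) w)} :
        Set (archLocal L 3 (Matrix.diagonal (α ∘ ⇑τ)) w))))
    [∀ τ, (νH τ).IsHaarMeasure] [∀ τ, (νH τ).IsInvInvariant] :
    haveI : ∀ τ : Perm (Fin 3), LocallyCompactSpace (archLocal L 3 (Matrix.diagonal (α ∘ ⇑τ)) w) := fun τ => locallyCompactSpace_archLocal L 3 (Matrix.diagonal (α ∘ ⇑τ)) w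
    haveI : ∀ τ : Perm (Fin 3), SecondCountableTopology (archLocal L 3 (Matrix.diagonal (α ∘ ⇑τ)) w) := fun τ => secondCountableTopology_archLocal L 3 (Matrix.diagonal (α ∘ ⇑τ)) w
    haveI : ∀ τ : Perm (Fin 3), (ν.map (ContinuousMulEquiv.restrictSubgroup (GLn.conjEquiv (Matrix.GeneralLinearGroup.mkOfDetNeZero _ (det_monomial_one_ne_zero 3 τ)))
                      (archLocal L 3 (Matrix.diagonal (α ∘ ⇑τ)) w) (archLocal L 3 (Matrix.diagonal α) w)
                      (mem_archLocal_comp_perm_iff_conj_mem L 3 α w τ)).symm).IsMulRightInvariant := fun τ => isMulRightInvariant_map_relabel_symm L 3 α w τ ν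
    haveI : ∀ τ : Perm (Fin 3), (ν.map (ContinuousMulEquiv.restrictSubgroup (GLn.conjEquiv (Matrix.GeneralLinearGroup.mkOfDetNeZero _ (det_monomial_one_ne_zero 3 τ)))
                      (archLocal L 3 (Matrix.diagonal (α ∘ ⇑τ)) w) (archLocal L 3 (Matrix.diagonal α) w)
                      (mem_archLocal_comp_perm_iff_conj_mem L 3 α w τ)).symm).IsHaarMeasure := fun _ => ContinuousMulEquiv.isHaarMeasure_map ν _
    ∃ c : Perm (Fin 3) → ℂ,
      (∀ τ : Perm (Fin 3), (w.1.embedding (α (τ 0))).re * (w.1.embedding (α (τ 2))).re < 0 → c τ ≠ 0) ∧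
      ∀ (Θ : Matrix (Fin 3) (Fin 3) (mixedSpace L) → ℂ), ContDiff ℝ (⊤ : ℕ∞) Θ →
        HasCompactSupport (fun g : arch (↥(maximalRealSubfield L)) L (IsCMField.complexConj L) 3 (Matrix.diagonal α) => Θ ((g : GL (Fin 3) (mixedSpace L)) : Matrix (Fin 3) (Fin 3) (mixedSpace L))) →
        ∀ (z : {w : InfinitePlace L // IsComplex w} → Fin 3 → Circle) (hz : ∀ v, v ≠ w → Function.Injective (z v)) (h02' : z w 0 = z w 2) (h01' : z w 0 ≠ z w 1),
          Tendsto (fun ψ : ℝ => deriv (fun ψ : ℝ => (2 * Real.sin ψ : ℂ) *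
              archStableOrbitalIntegral L 3 (Matrix.diagonal α) m
                (fun g : arch (↥(maximalRealSubfield L)) L (IsCMField.complexConj L) 3 (Matrix.diagonal α) => Θ ((g : GL (Fin 3) (mixedSpace L)) : Matrix (Fin 3) (Fin 3) (mixedSpace L)))
                (archDiagTorus L 3 α (Function.update z w fun i => z w i * Circle.exp (![(1 : ℝ), 0, -1] i * ψ)))) ψ)
            (𝓝[>] 0)
            (𝓝 (((∏ v : {w : InfinitePlace L // IsComplex w},
                  (Finset.univ.filter fun i => 0 < (v.1.embedding (α i)).re).card.factorial *
                    (3 - (Finset.univ.filter fun i => 0 < (v.1.embedding (α i)).re).card).factorial : ℕ) : ℂ)⁻¹ *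
              ∑ ρ : {w : InfinitePlace L // IsComplex w} → Perm (Fin 3),
              if 0 < (w.1.embedding (α ((ρ w)⁻¹ 0))).re * (w.1.embedding (α ((ρ w)⁻¹ 2))).re then
                2 * ∫ g : archLocal L 3 (Matrix.diagonal α) w,
                  (fun x' : archLocal L 3 (Matrix.diagonal α) w =>
          ∫ b : (∀ w' : {v : {w : InfinitePlace L // IsComplex w} // ¬ v = w}, archLocal L 3 (Matrix.diagonal α) w'.1),
            Θ ((((archPiEquivCM 3 L (Matrix.diagonal α)).symm
              ((MeasurableEquiv.piEquivPiSubtypeProd (fun v : {w : InfinitePlace L // IsComplex w} => ↥(archLocal L 3 (Matrix.diagonal α) v)) (· = w)).symm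
                ((MeasurableEquiv.piUnique fun i : {v : {w : InfinitePlace L // IsComplex w} // v = w} => ↥(archLocal L 3 (Matrix.diagonal α) i.1)).symm x',
                  fun w' => b w' * ⟨circleDiagonal 3 (z w'.1 ∘ ⇑(ρ w'.1)), circleDiagonal_mem_archLocal_diagonal L 3 α w'.1 (z w'.1 ∘ ⇑(ρ w'.1))⟩ * (b w')⁻¹)) :
                arch (↥(maximalRealSubfield L)) L (IsCMField.complexConj L) 3 (Matrix.diagonal α)) : GL (Fin 3) (mixedSpace L)) : Matrix (Fin 3) (Fin 3) (mixedSpace L))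
            ∂(Measure.pi fun w' : {v : {w : InfinitePlace L // IsComplex w} // ¬ v = w} => νw w'.1))
          (g * ⟨circleDiagonal 3 (z w ∘ ⇑(ρ w)), circleDiagonal_mem_archLocal_diagonal L 3 α w (z w ∘ ⇑(ρ w))⟩ * g⁻¹) ∂ν
              else
                c (ρ w)⁻¹ * ∫ y, descConj (⟨circleDiagonal 3 (z w), circleDiagonal_mem_archLocal_diagonal L 3 (α ∘ ⇑(ρ w)⁻¹) w (z w)⟩ : archLocal L 3 (Matrix.diagonal (α ∘ ⇑(ρ w)⁻¹)) w)
                  (Subgroup.centralizer ({(⟨circleDiagonal 3 z₁, circleDiagonal_mem_archLocal_diagonal L 3 (α ∘ ⇑(ρ w)⁻¹) w z₁⟩ :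
                    archLocal L 3 (Matrix.diagonal (α ∘ ⇑(ρ w)⁻¹)) w)} : Set (archLocal L 3 (Matrix.diagonal (α ∘ ⇑(ρ w)⁻¹)) w)))
                  (forall_mem_centralizer_circleDiagonal_comm_of_wall L (α ∘ ⇑(ρ w)⁻¹) w h02 h01 h02' h01')
                  (fun k : archLocal L 3 (Matrix.diagonal (α ∘ ⇑(ρ w)⁻¹)) w =>
                    (fun x' : archLocal L 3 (Matrix.diagonal α) w =>
          ∫ b : (∀ w' : {v : {w : InfinitePlace L // IsComplex w} // ¬ v = w}, archLocal L 3 (Matrix.diagonal α) w'.1),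
            Θ ((((archPiEquivCM 3 L (Matrix.diagonal α)).symm
              ((MeasurableEquiv.piEquivPiSubtypeProd (fun v : {w : InfinitePlace L // IsComplex w} => ↥(archLocal L 3 (Matrix.diagonal α) v)) (· = w)).symm
                ((MeasurableEquiv.piUnique fun i : {v : {w : InfinitePlace L // IsComplex w} // v = w} => ↥(archLocal L 3 (Matrix.diagonal α) i.1)).symm x',
                  fun w' => b w' * ⟨circleDiagonal 3 (z w'.1 ∘ ⇑(ρ w'.1)), circleDiagonal_mem_archLocal_diagonal L 3 α w'.1 (z w'.1 ∘ ⇑(ρ w'.1))⟩ * (b w')⁻¹)) :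
                arch (↥(maximalRealSubfield L)) L (IsCMField.complexConj L) 3 (Matrix.diagonal α)) : GL (Fin 3) (mixedSpace L)) : Matrix (Fin 3) (Fin 3) (mixedSpace L))
            ∂(Measure.pi fun w' : {v : {w : InfinitePlace L // IsComplex w} // ¬ v = w} => νw w'.1))
          ((ContinuousMulEquiv.restrictSubgroup (GLn.conjEquiv (Matrix.GeneralLinearGroup.mkOfDetNeZero _ (det_monomial_one_ne_zero 3 (ρ w)⁻¹)))
                      (archLocal L 3 (Matrix.diagonal (α ∘ ⇑(ρ w)⁻¹)) w) (archLocal L 3 (Matrix.diagonal α) w)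
                      (mem_archLocal_comp_perm_iff_conj_mem L 3 α w (ρ w)⁻¹)) k)) y
                  ∂(quotientMeasure _ (νH (ρ w)⁻¹) (isClosed_coe_centralizer_singleton _)
                    (ν.map (ContinuousMulEquiv.restrictSubgroup (GLn.conjEquiv (Matrix.GeneralLinearGroup.mkOfDetNeZero _ (det_monomial_one_ne_zero 3 (ρ w)⁻¹)))
                      (archLocal L 3 (Matrix.diagonal (α ∘ ⇑(ρ w)⁻¹)) w) (archLocal L 3 (Matrix.diagonal α) w)
                      (mem_archLocal_comp_perm_iff_conj_mem L 3 α w (ρ w)⁻¹)).symm)))) := by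
  classical
  haveI hLC : ∀ τ : Perm (Fin 3), LocallyCompactSpace (archLocal L 3 (Matrix.diagonal (α ∘ ⇑τ)) w) :=
    fun τ => locallyCompactSpace_archLocal L 3 (Matrix.diagonal (α ∘ ⇑τ)) w
  haveI hSC : ∀ τ : Perm (Fin 3), SecondCountableTopology (archLocal L 3 (Matrix.diagonal (α ∘ ⇑τ)) w) :=
    fun τ => secondCountableTopology_archLocal L 3 (Matrix.diagonal (α ∘ ⇑τ)) w
  haveI hLCv : ∀ v : {w : InfinitePlace L // IsComplex w}, LocallyCompactSpace (archLocal L 3 (Matrix.diagonal α) v) := fun v => locallyCompactSpace_archLocal L 3 (Matrix.diagonal α) v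
  haveI hSCv : ∀ v : {w : InfinitePlace L // IsComplex w}, SecondCountableTopology (archLocal L 3 (Matrix.diagonal α) v) := fun v => secondCountableTopology_archLocal L 3 (Matrix.diagonal α) v
  -- (no `haveI` for the transported measures here: the statement inlines them, and instance families over `Measure.map` terms slow down every search)
  have hreal : ∀ i, (w.1.embedding (α i)).im = 0 := fun i => im_embedding_eq_zero_of_complexConj_eq L w (hherm i)
  obtain ⟨c, hc, hJ1⟩ := exists_tendsto_deriv_sin_mul_sum_integral_comp_conj_splitCurve_comp_perm L α w hα hreal hJ ν z₁ h02 h01 νH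
  refine ⟨c, hc, fun Θ hΘ hΘc z hz h02' h01' => ?_⟩
  have hΘcont : Continuous Θ := hΘ.continuous
  -- one smooth `Θ' σ` on `M₃(ℂ)` per global relabelling `σ`, agreeing on `G_w` with the partial orbital lambda at `(z_v ∘ σ_v)_v` (★ (V7)-smooth §4)
  have hex : ∀ σ : {w : InfinitePlace L // IsComplex w} → Perm (Fin 3), ∃ Θ' : Matrix (Fin 3) (Fin 3) ℂ → ℂ, ContDiff ℝ (⊤ : ℕ∞) Θ' ∧
      HasCompactSupport (fun k : archLocal L 3 (Matrix.diagonal α) w => Θ' ((k : GL (Fin 3) ℂ) : Matrix (Fin 3) (Fin 3) ℂ)) ∧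
      ∀ x' : archLocal L 3 (Matrix.diagonal α) w, Θ' ((x' : GL (Fin 3) ℂ) : Matrix (Fin 3) (Fin 3) ℂ) =
        (fun x' : archLocal L 3 (Matrix.diagonal α) w =>
          ∫ b : (∀ w' : {v : {w : InfinitePlace L // IsComplex w} // ¬ v = w}, archLocal L 3 (Matrix.diagonal α) w'.1),
            Θ ((((archPiEquivCM 3 L (Matrix.diagonal α)).symm
              ((MeasurableEquiv.piEquivPiSubtypeProd (fun v : {w : InfinitePlace L // IsComplex w} => ↥(archLocal L 3 (Matrix.diagonal α) v)) (· = w)).symm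
                ((MeasurableEquiv.piUnique fun i : {v : {w : InfinitePlace L // IsComplex w} // v = w} => ↥(archLocal L 3 (Matrix.diagonal α) i.1)).symm x',
                  fun w' => b w' * ⟨circleDiagonal 3 (z w'.1 ∘ ⇑(σ w'.1)), circleDiagonal_mem_archLocal_diagonal L 3 α w'.1 (z w'.1 ∘ ⇑(σ w'.1))⟩ * (b w')⁻¹)) :
                arch (↥(maximalRealSubfield L)) L (IsCMField.complexConj L) 3 (Matrix.diagonal α)) : GL (Fin 3) (mixedSpace L)) : Matrix (Fin 3) (Fin 3) (mixedSpace L))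
            ∂(Measure.pi fun w' : {v : {w : InfinitePlace L // IsComplex w} // ¬ v = w} => νw w'.1))
          (x') := fun σ =>
    exists_contDiff_partialOrbital_eq L 3 α νw hα w Θ hΘ hΘc (z := fun v => z v ∘ ⇑(σ v)) fun v hv => (hz v hv).comp (σ v).injective
  choose Θ' hΘ'd hΘ'c hΘ'eq using hex
  -- the constant of ★ (j2)
  set K : ℂ := ((∏ v : {w : InfinitePlace L // IsComplex w},
                  (Finset.univ.filter fun i => 0 < (v.1.embedding (α i)).re).card.factorial *
                    (3 - (Finset.univ.filter fun i => 0 < (v.1.embedding (α i)).re).card).factorial : ℕ) : ℂ) with hK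
  -- (1) J1 at `w` for each off-`w` relabelling `ρ'`, with `Θ := Θ' (1, ρ')`
  have hlim := fun ρ' : {v : {w : InfinitePlace L // IsComplex w} // v ≠ w} → Perm (Fin 3) => hJ1 (Θ' ((Equiv.funSplitAt w (Perm (Fin 3))).symm (1, ρ'))) (hΘ'd _) (hΘ'c _) (z w) h02' h01'
  have hsum := (tendsto_finsetSum (Finset.univ : Finset ({v : {w : InfinitePlace L // IsComplex w} // v ≠ w} → Perm (Fin 3))) fun ρ' _ => hlim ρ').const_mul K⁻¹
  -- (2) the regularity window and the pointwise identity of the functions on it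
  obtain ⟨ε, hε, hregε⟩ : ∃ ε > 0, ∀ ψ : ℝ, 0 < ψ → ψ < ε → ∀ (ρ : {w : InfinitePlace L // IsComplex w} → Perm (Fin 3)) (v : {w : InfinitePlace L // IsComplex w}),
      Function.Injective (Function.update z w (fun i => z w i * Circle.exp (![(1 : ℝ), 0, -1] i * ψ)) v ∘ ⇑(ρ v)) := by
    have h := eventually_forall_injective_update_splitCurve_comp L w z hz h02' h01'
    rw [eventually_nhdsWithin_iff, Metric.eventually_nhds_iff] at h
    obtain ⟨ε, hε, h⟩ := h
    exact ⟨ε, hε, fun ψ h0 hψε => h (by rw [Real.dist_eq, sub_zero, abs_of_pos h0]; exact hψε) h0⟩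
  -- every global summand is the `w`-torus orbital integral of the partial orbital lambda (§2), i.e. of `Θ' (1, ρ|)`
  have hPO : ∀ (ρ : {w : InfinitePlace L // IsComplex w} → Perm (Fin 3)) (x' : archLocal L 3 (Matrix.diagonal α) w),
      (fun x' : archLocal L 3 (Matrix.diagonal α) w =>
        ∫ b : (∀ w' : {v : {w : InfinitePlace L // IsComplex w} // ¬ v = w}, archLocal L 3 (Matrix.diagonal α) w'.1),
          Θ ((((archPiEquivCM 3 L (Matrix.diagonal α)).symm
            ((MeasurableEquiv.piEquivPiSubtypeProd (fun v : {w : InfinitePlace L // IsComplex w} => ↥(archLocal L 3 (Matrix.diagonal α) v)) (· = w)).symm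
              ((MeasurableEquiv.piUnique fun i : {v : {w : InfinitePlace L // IsComplex w} // v = w} => ↥(archLocal L 3 (Matrix.diagonal α) i.1)).symm x',
                fun w' => b w' * ⟨circleDiagonal 3 (z w'.1 ∘ ⇑(ρ w'.1)), circleDiagonal_mem_archLocal_diagonal L 3 α w'.1 (z w'.1 ∘ ⇑(ρ w'.1))⟩ * (b w')⁻¹)) :
              arch (↥(maximalRealSubfield L)) L (IsCMField.complexConj L) 3 (Matrix.diagonal α)) : GL (Fin 3) (mixedSpace L)) : Matrix (Fin 3) (Fin 3) (mixedSpace L))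
          ∂(Measure.pi fun w' : {v : {w : InfinitePlace L // IsComplex w} // ¬ v = w} => νw w'.1))
        (x') =
        Θ' ((Equiv.funSplitAt w (Perm (Fin 3))).symm (1, fun v => ρ v.1)) ((x' : GL (Fin 3) ℂ) : Matrix (Fin 3) (Fin 3) ℂ) := fun ρ x' => by
    rw [hΘ'eq]
    simp only [funSplitAt_symm_apply_coe]
  have hpt : ∀ ψ : ℝ, 0 < ψ → ψ < ε →
      (2 * Real.sin ψ : ℂ) * archStableOrbitalIntegral L 3 (Matrix.diagonal α) m
          (fun g : arch (↥(maximalRealSubfield L)) L (IsCMField.complexConj L) 3 (Matrix.diagonal α) => Θ ((g : GL (Fin 3) (mixedSpace L)) : Matrix (Fin 3) (Fin 3) (mixedSpace L)))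
          (archDiagTorus L 3 α (Function.update z w fun i => z w i * Circle.exp (![(1 : ℝ), 0, -1] i * ψ))) =
        K⁻¹ * ∑ ρ' : {v : {w : InfinitePlace L // IsComplex w} // v ≠ w} → Perm (Fin 3), (fun ψ : ℝ => (2 * Real.sin ψ : ℂ) * ∑ ρ₀ : Perm (Fin 3), ∫ g : archLocal L 3 (Matrix.diagonal α) w,
              Θ' ((Equiv.funSplitAt w (Perm (Fin 3))).symm (1, ρ')) ((((g * ⟨circleDiagonal 3 ((fun i => z w i * Circle.exp (![(1 : ℝ), 0, -1] i * ψ)) ∘ ⇑ρ₀), circleDiagonal_mem_archLocal_diagonal L 3 α w _⟩ * g⁻¹ :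
                archLocal L 3 (Matrix.diagonal α) w) : GL (Fin 3) ℂ) : Matrix (Fin 3) (Fin 3) ℂ)) ∂ν) ψ := by
    intro ψ h0 hψε
    have hreg := hregε ψ h0 hψε
    have hreg1 : ∀ v, Function.Injective (Function.update z w (fun i => z w i * Circle.exp (![(1 : ℝ), 0, -1] i * ψ)) v) := fun v => by
      simpa using hreg (fun _ => 1) v
    have ha : Continuous fun g : arch (↥(maximalRealSubfield L)) L (IsCMField.complexConj L) 3 (Matrix.diagonal α) => Θ ((g : GL (Fin 3) (mixedSpace L)) : Matrix (Fin 3) (Fin 3) (mixedSpace L)) :=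
      hΘcont.comp (Units.continuous_val.comp continuous_subtype_val)
    rw [archStableOrbitalIntegral_archDiagTorus_eq_inv_mul_sum_integral_conj L 3 α hα hherm hm hreg1
      (fun g : arch (↥(maximalRealSubfield L)) L (IsCMField.complexConj L) 3 (Matrix.diagonal α) => Θ ((g : GL (Fin 3) (mixedSpace L)) : Matrix (Fin 3) (Fin 3) (mixedSpace L))) ha]
    have hterm : ∀ ρ : {w : InfinitePlace L // IsComplex w} → Perm (Fin 3),
        ∫ g, Θ (((g * archDiagTorus L 3 α (fun v => Function.update z w (fun i => z w i * Circle.exp (![(1 : ℝ), 0, -1] i * ψ)) v ∘ ⇑(ρ v)) * g⁻¹ : arch (↥(maximalRealSubfield L)) L (IsCMField.complexConj L) 3 (Matrix.diagonal α)) :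
            GL (Fin 3) (mixedSpace L)) : Matrix (Fin 3) (Fin 3) (mixedSpace L)) ∂νinf =
          ∫ g : archLocal L 3 (Matrix.diagonal α) w,
            Θ' ((Equiv.funSplitAt w (Perm (Fin 3))).symm (1, fun v => ρ v.1)) ((((g * ⟨circleDiagonal 3 ((fun i => z w i * Circle.exp (![(1 : ℝ), 0, -1] i * ψ)) ∘ ⇑(ρ w)), circleDiagonal_mem_archLocal_diagonal L 3 α w _⟩ * g⁻¹ :
              archLocal L 3 (Matrix.diagonal α) w) : GL (Fin 3) ℂ) : Matrix (Fin 3) (Fin 3) ℂ)) ∂ν := fun ρ => by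
      rw [hνinf, integral_comp_conj_archDiagTorus_update_comp_eq_integral_partial L α w νw hα Θ hΘcont hΘc z _ ρ (hreg ρ), hνw]
      exact integral_congr_ae (ae_of_all _ fun g => hPO ρ _)
    simp only [hterm]
    rw [← Finset.mul_sum, ← sum_eq_sum_sum_funSplitAt L w (fun (ρ₀ : Perm (Fin 3)) (ρ' : {v : {w : InfinitePlace L // IsComplex w} // v ≠ w} → Perm (Fin 3)) =>
      ∫ g : archLocal L 3 (Matrix.diagonal α) w,
        Θ' ((Equiv.funSplitAt w (Perm (Fin 3))).symm (1, ρ')) ((((g * ⟨circleDiagonal 3 ((fun i => z w i * Circle.exp (![(1 : ℝ), 0, -1] i * ψ)) ∘ ⇑ρ₀), circleDiagonal_mem_archLocal_diagonal L 3 α w _⟩ * g⁻¹ :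
          archLocal L 3 (Matrix.diagonal α) w) : GL (Fin 3) ℂ) : Matrix (Fin 3) (Fin 3) ℂ)) ∂ν), ← hK]
    ring
  -- (3) hence the derivatives agree on the window, and `deriv (K⁻¹ · Σ_{ρ'} F_{ρ'}) = K⁻¹ · Σ_{ρ'} deriv F_{ρ'}` there (J1 §1 differentiability)
  have hev : ∀ᶠ ψ in 𝓝[>] (0 : ℝ), deriv (fun ψ : ℝ => (2 * Real.sin ψ : ℂ) *
              archStableOrbitalIntegral L 3 (Matrix.diagonal α) m
                (fun g : arch (↥(maximalRealSubfield L)) L (IsCMField.complexConj L) 3 (Matrix.diagonal α) => Θ ((g : GL (Fin 3) (mixedSpace L)) : Matrix (Fin 3) (Fin 3) (mixedSpace L)))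
                (archDiagTorus L 3 α (Function.update z w fun i => z w i * Circle.exp (![(1 : ℝ), 0, -1] i * ψ)))) ψ =
      K⁻¹ * ∑ ρ' : {v : {w : InfinitePlace L // IsComplex w} // v ≠ w} → Perm (Fin 3), deriv (fun ψ : ℝ => (2 * Real.sin ψ : ℂ) * ∑ ρ₀ : Perm (Fin 3), ∫ g : archLocal L 3 (Matrix.diagonal α) w,
              Θ' ((Equiv.funSplitAt w (Perm (Fin 3))).symm (1, ρ')) ((((g * ⟨circleDiagonal 3 ((fun i => z w i * Circle.exp (![(1 : ℝ), 0, -1] i * ψ)) ∘ ⇑ρ₀), circleDiagonal_mem_archLocal_diagonal L 3 α w _⟩ * g⁻¹ :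
                archLocal L 3 (Matrix.diagonal α) w) : GL (Fin 3) ℂ) : Matrix (Fin 3) (Fin 3) ℂ)) ∂ν) ψ := by
    filter_upwards [Ioo_mem_nhdsGT hε] with ψ hψ
    have hψinj : Function.Injective (fun i => z w i * Circle.exp (![(1 : ℝ), 0, -1] i * ψ)) := by
      simpa using hregε ψ hψ.1 hψ.2 (fun _ => 1) w
    -- the two functions agree near `ψ`
    have hnhds : ∀ᶠ ψ' in 𝓝 ψ, (fun ψ : ℝ => (2 * Real.sin ψ : ℂ) *
              archStableOrbitalIntegral L 3 (Matrix.diagonal α) m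
                (fun g : arch (↥(maximalRealSubfield L)) L (IsCMField.complexConj L) 3 (Matrix.diagonal α) => Θ ((g : GL (Fin 3) (mixedSpace L)) : Matrix (Fin 3) (Fin 3) (mixedSpace L)))
                (archDiagTorus L 3 α (Function.update z w fun i => z w i * Circle.exp (![(1 : ℝ), 0, -1] i * ψ)))) ψ' =
        (fun ψ' : ℝ => K⁻¹ * ∑ ρ' : {v : {w : InfinitePlace L // IsComplex w} // v ≠ w} → Perm (Fin 3), (fun ψ : ℝ => (2 * Real.sin ψ : ℂ) * ∑ ρ₀ : Perm (Fin 3), ∫ g : archLocal L 3 (Matrix.diagonal α) w,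
              Θ' ((Equiv.funSplitAt w (Perm (Fin 3))).symm (1, ρ')) ((((g * ⟨circleDiagonal 3 ((fun i => z w i * Circle.exp (![(1 : ℝ), 0, -1] i * ψ)) ∘ ⇑ρ₀), circleDiagonal_mem_archLocal_diagonal L 3 α w _⟩ * g⁻¹ :
                archLocal L 3 (Matrix.diagonal α) w) : GL (Fin 3) ℂ) : Matrix (Fin 3) (Fin 3) ℂ)) ∂ν) ψ') ψ' := by
      filter_upwards [isOpen_Ioo.mem_nhds hψ] with ψ' hψ'
      exact hpt ψ' hψ'.1 hψ'.2
    rw [Filter.EventuallyEq.deriv_eq hnhds]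
    -- differentiability of each `F_{ρ'}` at `ψ` (J1 §1)
    have hsin : DifferentiableAt ℝ (fun ψ : ℝ => (2 * Real.sin ψ : ℂ)) ψ :=
      (((Real.hasDerivAt_sin ψ).ofReal_comp).const_mul (2 : ℂ)).differentiableAt
    have hF : ∀ ρ' : {v : {w : InfinitePlace L // IsComplex w} // v ≠ w} → Perm (Fin 3), DifferentiableAt ℝ (fun ψ : ℝ => (2 * Real.sin ψ : ℂ) * ∑ ρ₀ : Perm (Fin 3), ∫ g : archLocal L 3 (Matrix.diagonal α) w,
              Θ' ((Equiv.funSplitAt w (Perm (Fin 3))).symm (1, ρ')) ((((g * ⟨circleDiagonal 3 ((fun i => z w i * Circle.exp (![(1 : ℝ), 0, -1] i * ψ)) ∘ ⇑ρ₀), circleDiagonal_mem_archLocal_diagonal L 3 α w _⟩ * g⁻¹ :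
                archLocal L 3 (Matrix.diagonal α) w) : GL (Fin 3) ℂ) : Matrix (Fin 3) (Fin 3) ℂ)) ∂ν) ψ := fun ρ' =>
      hsin.mul (DifferentiableAt.fun_sum fun ρ₀ _ =>
        differentiableAt_integral_comp_conj_splitCurve_comp_perm L α w hα hreal ν (Θ' ((Equiv.funSplitAt w (Perm (Fin 3))).symm (1, ρ')))
          ((hΘ'd _).of_le (by exact_mod_cast le_top)) (hΘ'c _) (z w) ρ₀ hψinj)
    have hfun : (fun ψ' : ℝ => ∑ ρ' : {v : {w : InfinitePlace L // IsComplex w} // v ≠ w} → Perm (Fin 3), (fun ψ : ℝ => (2 * Real.sin ψ : ℂ) * ∑ ρ₀ : Perm (Fin 3), ∫ g : archLocal L 3 (Matrix.diagonal α) w,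
              Θ' ((Equiv.funSplitAt w (Perm (Fin 3))).symm (1, ρ')) ((((g * ⟨circleDiagonal 3 ((fun i => z w i * Circle.exp (![(1 : ℝ), 0, -1] i * ψ)) ∘ ⇑ρ₀), circleDiagonal_mem_archLocal_diagonal L 3 α w _⟩ * g⁻¹ :
                archLocal L 3 (Matrix.diagonal α) w) : GL (Fin 3) ℂ) : Matrix (Fin 3) (Fin 3) ℂ)) ∂ν) ψ') =
        (∑ ρ' : {v : {w : InfinitePlace L // IsComplex w} // v ≠ w} → Perm (Fin 3), (fun ψ : ℝ => (2 * Real.sin ψ : ℂ) * ∑ ρ₀ : Perm (Fin 3), ∫ g : archLocal L 3 (Matrix.diagonal α) w,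
              Θ' ((Equiv.funSplitAt w (Perm (Fin 3))).symm (1, ρ')) ((((g * ⟨circleDiagonal 3 ((fun i => z w i * Circle.exp (![(1 : ℝ), 0, -1] i * ψ)) ∘ ⇑ρ₀), circleDiagonal_mem_archLocal_diagonal L 3 α w _⟩ * g⁻¹ :
                archLocal L 3 (Matrix.diagonal α) w) : GL (Fin 3) ℂ) : Matrix (Fin 3) (Fin 3) ℂ)) ∂ν)) := by
      funext ψ'
      rw [Finset.sum_apply]
    rw [deriv_const_mul _ (DifferentiableAt.fun_sum fun ρ' _ => hF ρ'), hfun, deriv_sum fun ρ' _ => hF ρ']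
  -- (4) assemble: J1 termwise, summed, transported along the eventual equality; then read the right-hand side in the group currency
  have h2 := hsum.congr' (hev.mono fun ψ h => h.symm)
  convert h2 using 3
  rw [← sum_eq_sum_sum_funSplitAt L w]
  refine Finset.sum_congr rfl fun ρ _ => ?_
  congr 1
  · congr 1
    exact integral_congr_ae (ae_of_all _ fun g => hPO ρ _)
  · congr 1
    refine integral_congr_ae (ae_of_all _ fun y => ?_)
    congr 2
    funext k
    rw [hPO, apply_coe_relabel L 3 α w (ρ w)⁻¹ (Θ' ((Equiv.funSplitAt w (Perm (Fin 3))).symm (1, fun v => ρ v.1)))]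

end Literature.NumberTheory.Rogawski1990

end
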